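import Summits.NavierStokesRegularity.NavierStokesRegularity.Theorems.ScenarioCensusRowF19Top

/-!
# Census row F19 «quasi-steady top» — part 2/2: F-qs from row F1a BY NAME, the sub-rows, top unsteadiness,
# `TypeIQuasiSteadiness ↔ Row_F1`; census keys

Re-homed for the scenario census (typer seat ns-census-typer-1 g5; lead g7 MINT INTENT F19 16:06Z) from ns-idea-3 g6's LINE 11
«quasi-steady-top» (`line-quasi-steady-top.lean`, sha16 9bb49646717cc843), continuing `ScenarioCensusRowF19Top` (part 1/2).  Lean text
verbatim in namespace `…Theorems.ScenarioCensus.QuasiSteadyTop`.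

Mechanism (all in kernel): fix `x` and compare `s ↦ |u(s,x)|` on `[t₁,t]` with the barrier
`B(s) = K + 2δ'√ν((T−s)^{-1/2} − (T−t₁)^{-1/2})` (`norm_le_of_quasiSteady`): where `|u| = B > Λ` the point is fast, so
`|∂ₜ|u|| ≤ ‖∂ₜu‖ < B'`; hence the SMALL eventual Type-I rate `√(T−t)|u| ≤ (δ + 9 − 2√15)√ν < (18 − 4√15)√ν`, and census row F1a
(`ScenarioCensus.row_F1a_excluded`, the tree's depletion ladder) extends the solution: `rowFqs_of_rowF1a`, `rowFqs_holds`; sub-rows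
`rowFfrozen_holds`, `rowFdtSup_holds`, `rowF1qs_holds`; structural `topUnsteadiness_holds`; `typeIQuasiSteadiness_iff_rowF1`,
`rowF1_of_typeIQuasiSteadiness`.
Census keys (namespace `…Theorems.ScenarioCensus`): `Row_F19` (= `QuasiSteadyTop.Row_Fqs`) + `row_F19_excluded`; in-row `Row_F19fr` +
`row_F19fr_excluded` (frozen top), `Row_F19dt` + `row_F19dt_excluded` (F-∂t∞), `Row_F1qs` + `row_F1qs_excluded`; lattice
`row_F19_of_row_F1a`; display `row_F1_iff_typeIQuasiSteadiness`.

No census value is asserted here (the lead books F19); NS regularity is NOT proved; `Row_F1` stays open (≡ `TypeIQuasiSteadiness`);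
no summit statement is proved by this file.
-/

noncomputable section

set_option linter.dupNamespace false

open MeasureTheory Set Function Filter TopologicalSpace Metric
open scoped Topology NNReal ENNReal

namespace Summit.NavierStokesRegularity.NavierStokesRegularity.Theorems.ScenarioCensus.QuasiSteadyTop

open Literature.Analysis Literature.Analysis.FluidPDE
open Summit.NavierStokesRegularity.NavierStokesRegularity.Theorems

/-- **Row F-qs from row F1a** (the lattice edge F-qs ⊂ F1a, BY NAME): a quasi-steady top with modulus
`δ < 9 − 2√15` forces the SMALL eventual rate `√(T−t)|u| ≤ (δ + 9 − 2√15)√ν < (18 − 4√15)√ν`, and row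
F1a extends the solution. [folklore] -/
theorem rowFqs_of_rowF1a (hF1a : ScenarioCensus.Row_F1a) : Row_Fqs := by
  intro ν T δ hν hT hδ hδlt u p hsol hLH hdec hqs
  obtain ⟨Λ, hev⟩ := hqs
  -- a window `(T₀, T)` on which the top bound holds
  obtain ⟨T₀, hT₀T, hT₀⟩ := mem_nhdsLT_iff_exists_Ioo_subset.1 hev
  -- an interior time `t₁ ∈ (max T₀ 0, T)` and a sup bound there
  set t₁ : ℝ := (max T₀ 0 + T) / 2 with ht₁def
  have ht₁0 : 0 < t₁ := by
    have : 0 ≤ max T₀ 0 := le_max_right _ _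
    rw [ht₁def]; linarith
  have ht₁T : t₁ < T := by
    have : max T₀ 0 < T := max_lt hT₀T hT
    rw [ht₁def]; linarith
  have hT₀t₁ : T₀ < t₁ := by
    have h1 : T₀ ≤ max T₀ 0 := le_max_left _ _
    have h2 : max T₀ 0 < T := max_lt hT₀T hT
    rw [ht₁def]; linarith
  obtain ⟨M, hM0, hM⟩ := exists_sup_bound_at hν hT hsol hLH hdec ⟨ht₁0, ht₁T⟩
  -- constants: gap `g`, strict modulus `δ' = δ + g/4`, rate constant `C = δ + 9 − 2√15 = 2δ + g`
  set g : ℝ := 9 - 2 * Real.sqrt 15 - δ with hgdef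
  have hg : 0 < g := by rw [hgdef]; linarith
  have hsν : 0 < Real.sqrt ν := Real.sqrt_pos.2 hν
  set δc : ℝ := (δ + g / 4) * Real.sqrt ν with hδcdef
  have hδc : 0 ≤ δc := by rw [hδcdef]; positivity
  have hqs' : ∀ s ∈ Ico t₁ T, ∀ x, Λ < ‖u s x‖ →
      ‖timeDerivWithin (Ico 0 T) u s x‖ < δc / ((T - s) * Real.sqrt (T - s)) := by
    intro s hs x hΛ
    have hsT : 0 < T - s := sub_pos.2 hs.2
    have hden : 0 < (T - s) * Real.sqrt (T - s) := mul_pos hsT (Real.sqrt_pos.2 hsT)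
    have h := hT₀ ⟨hT₀t₁.trans_le hs.1, hs.2⟩ x hΛ
    refine lt_of_le_of_lt h (div_lt_div_of_pos_right ?_ hden)
    rw [hδcdef]
    have : δ < δ + g / 4 := by linarith
    exact mul_lt_mul_of_pos_right this hsν
  have hbound := norm_le_of_quasiSteady hsol ht₁0 hδc hM hqs'
  set K : ℝ := M + max Λ 0 + 1 with hKdef
  have hK0 : 0 < K := by
    have : 0 ≤ max Λ 0 := le_max_right _ _
    rw [hKdef]; linarith
  -- the small eventual rate
  set C : ℝ := δ + 9 - 2 * Real.sqrt 15 with hCdef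
  have hC0 : 0 < C := by rw [hCdef]; linarith [deltaStar_pos]
  have hκC : (9 + 2 * Real.sqrt 15) / 42 * C < 1 := by rw [hCdef]; exact kappa_mul_lt_one hδlt
  -- choose `t₂` with `K √(T−t) ≤ (g/2)√ν` on `(t₂, T)`
  set ρ : ℝ := (g * Real.sqrt ν / (2 * K)) ^ 2 with hρdef
  have hρ : 0 < ρ := by rw [hρdef]; positivity
  set t₂ : ℝ := max t₁ (T - ρ) with ht₂def
  have ht₂T : t₂ < T := max_lt ht₁T (by linarith)
  have hrate : ∀ᶠ t in 𝓝[<] T, ∀ x, Real.sqrt (T - t) * ‖u t x‖ ≤ C * Real.sqrt ν := by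
    filter_upwards [Ioo_mem_nhdsLT ht₂T] with t ht x
    have ht₁t : t₁ ≤ t := (le_max_left _ _).trans ht.1.le
    have hTt : 0 < T - t := sub_pos.2 ht.2
    have hsq : 0 < Real.sqrt (T - t) := Real.sqrt_pos.2 hTt
    have h1 := hbound t ⟨ht₁t, ht.2⟩ x
    -- drop the negative anchor term and multiply by `√(T−t)`
    have h2 : ‖u t x‖ ≤ K + 2 * δc * (Real.sqrt (T - t))⁻¹ := by
      have hnn : 0 ≤ (Real.sqrt (T - t₁))⁻¹ := inv_nonneg.2 (Real.sqrt_nonneg _)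
      have : 2 * δc * ((Real.sqrt (T - t))⁻¹ - (Real.sqrt (T - t₁))⁻¹) ≤
          2 * δc * (Real.sqrt (T - t))⁻¹ :=
        mul_le_mul_of_nonneg_left (by linarith) (by positivity)
      rw [hKdef]; linarith
    have h3 : Real.sqrt (T - t) * ‖u t x‖ ≤ K * Real.sqrt (T - t) + 2 * δc := by
      have := mul_le_mul_of_nonneg_left h2 hsq.le
      have e : Real.sqrt (T - t) * (K + 2 * δc * (Real.sqrt (T - t))⁻¹) =
          K * Real.sqrt (T - t) + 2 * δc := by
        field_simp
      linarith [e ▸ this]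
    -- `√(T−t) ≤ g√ν/(2K)` on the window
    have h4 : Real.sqrt (T - t) ≤ g * Real.sqrt ν / (2 * K) := by
      have hTtρ : T - t ≤ ρ := by
        have : T - ρ ≤ t := (le_max_right _ _).trans ht.1.le
        linarith
      have hnn : 0 ≤ g * Real.sqrt ν / (2 * K) := by positivity
      calc Real.sqrt (T - t) ≤ Real.sqrt ρ := Real.sqrt_le_sqrt hTtρ
        _ = g * Real.sqrt ν / (2 * K) := by rw [hρdef, Real.sqrt_sq hnn]
    have h5 : K * Real.sqrt (T - t) ≤ g * Real.sqrt ν / 2 := by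
      have := mul_le_mul_of_nonneg_left h4 hK0.le
      have e : K * (g * Real.sqrt ν / (2 * K)) = g * Real.sqrt ν / 2 := by
        field_simp
      linarith [e ▸ this]
    have h6 : 2 * δc = (2 * δ + g / 2) * Real.sqrt ν := by rw [hδcdef]; ring
    have h7 : C * Real.sqrt ν = (2 * δ + g) * Real.sqrt ν := by rw [hCdef, hgdef]; ring
    rw [h7]
    nlinarith [h3, h5, h6, hsν.le]
  exact hF1a ν T C hν hT hC0 hκC u p hsol hLH hdec hrate

/-- **Row F-qs is EXCLUDED (kernel)**, from row F1a BY NAME (`ScenarioCensus.row_F1a_excluded`). [folklore] -/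
theorem rowFqs_holds : Row_Fqs := rowFqs_of_rowF1a ScenarioCensus.row_F1a_excluded

/-! ## §4 Sub-rows, the structural theorem, the residual -/

/-- F-frozen ⊂ F-qs (`δ = 0`). [folklore] -/
theorem rowFfrozen_of_rowFqs (h : Row_Fqs) : Row_Ffrozen := by
  intro ν T hν hT u p hsol hLH hdec hfr
  obtain ⟨Λ, hev⟩ := hfr
  refine h ν T 0 hν hT le_rfl deltaStar_pos u p hsol hLH hdec ⟨Λ, ?_⟩
  filter_upwards [hev] with t ht x hΛ
  rw [ht x hΛ, norm_zero]
  simp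

/-- F-∂t∞ ⊂ F-qs (`Λ = −1`: every point counts as fast). [folklore] -/
theorem rowFdtSup_of_rowFqs (h : Row_Fqs) : Row_FdtSup := by
  intro ν T δ hν hT hδ hδlt u p hsol hLH hdec hev
  refine h ν T δ hν hT hδ hδlt u p hsol hLH hdec ⟨-1, ?_⟩
  filter_upwards [hev] with t ht x _ using ht x

/-- F1qs ⊂ F-qs (the Type-I rate is not used). [folklore] -/
theorem rowF1qs_of_rowFqs (h : Row_Fqs) : Row_F1qs :=
  fun ν T δ hν hT hδ hδlt u p hsol hLH hdec _ hqs => h ν T δ hν hT hδ hδlt u p hsol hLH hdec hqs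

/-- **Sub-row F-frozen EXCLUDED (kernel).** [folklore] -/
theorem rowFfrozen_holds : Row_Ffrozen := rowFfrozen_of_rowFqs rowFqs_holds

/-- **Sub-row F-∂t∞ EXCLUDED (kernel).** [folklore] -/
theorem rowFdtSup_holds : Row_FdtSup := rowFdtSup_of_rowFqs rowFqs_holds

/-- **Type-I member F1qs EXCLUDED (kernel).** [folklore] -/
theorem rowF1qs_holds : Row_F1qs := rowF1qs_of_rowFqs rowFqs_holds

/-- **TOP UNSTEADINESS of every Clay blow-up** (structural theorem, kernel): the fast fluid of a maximal
classical Leray–Hopf solution from a rapidly decaying datum uses, at fast points arbitrarily close to `T` and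
above every speed level, MORE THAN `δ√ν(T−t)^{-3/2}` of the blow-up clock, for every `δ < 9 − 2√15`.
[folklore] -/
theorem topUnsteadiness_holds : TopUnsteadiness := by
  intro ν T hν hT u p hmax hLH hdec δ Λ t₁ hδ hδlt ht₁T
  by_contra hcon
  push Not at hcon
  have hqs : HasQuasiSteadyTop ν T δ u := by
    refine ⟨Λ, ?_⟩
    filter_upwards [Ioo_mem_nhdsLT ht₁T] with t ht x hΛ using hcon t ht x hΛ
  exact hmax.2 (rowFqs_holds ν T δ hν hT hδ hδlt u p hmax.1 hLH hdec hqs)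

/-- **The split**: Type-I member + residual ⇒ row F1 (by cases on extendability). [folklore] -/
theorem rowF1_of (hD : Row_F1qs) (hR : TypeIQuasiSteadiness) : ScenarioCensus.Row_F1 := by
  unfold ScenarioCensus.Row_F1
  intro ν T hν hT u p hsol hLH hdec hTI
  by_contra hext
  obtain ⟨δ, hδ, hδlt, hqs⟩ := hR ν T hν hT u p ⟨hsol, hext⟩ hLH hdec hTI
  exact hext (hD ν T δ hν hT hδ hδlt u p hsol hLH hdec hTI hqs)

/-- The residual is a consequence of the row (vacuously: under `Row_F1` no maximal solution is Type I).
[folklore] -/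
theorem typeIQuasiSteadiness_of_rowF1 (h : ScenarioCensus.Row_F1) : TypeIQuasiSteadiness :=
  fun ν T hν hT u p hmax hLH hdec hTI => (hmax.2 (h ν T hν hT u p hmax.1 hLH hdec hTI)).elim

/-- **The residual is EXACTLY row F1** (declared equivalence, kernel). [folklore] -/
theorem typeIQuasiSteadiness_iff_rowF1 : TypeIQuasiSteadiness ↔ ScenarioCensus.Row_F1 :=
  ⟨fun hR => rowF1_of rowF1qs_holds hR, typeIQuasiSteadiness_of_rowF1⟩

/-- **Composition concluding the target BY NAME**: the residual alone now implies `Row_F1`. [folklore] -/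
theorem rowF1_of_typeIQuasiSteadiness : TypeIQuasiSteadiness → ScenarioCensus.Row_F1 :=
  typeIQuasiSteadiness_iff_rowF1.1

end Summit.NavierStokesRegularity.NavierStokesRegularity.Theorems.ScenarioCensus.QuasiSteadyTop

namespace Summit.NavierStokesRegularity.NavierStokesRegularity.Theorems.ScenarioCensus

/-- Census row F19 — (I ∨ II, NO rate assumed · forward, Clay frame: classical on `[0,T)`, Leray–Hopf from a rapidly decaying
datum · no symmetry; instead the KINEMATIC constraint «quasi-steady top»: for some speed level `Λ`, at all fast points
`Λ < |u(t,x)|` near `T`, `‖∂ₜu(t,x)‖ ≤ δ√ν (T−t)^{-3/2}` with `0 ≤ δ < 9 − 2√15`): extends past `T`, BY NAME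
`QuasiSteadyTop.Row_Fqs` (ns-idea-3 LINE «quasi-steady-top», VERBATIM).  Closed by `row_F19_excluded`; the census lead books
the value. -/
def Row_F19 : Prop := QuasiSteadyTop.Row_Fqs

/-- F19 is PROVED in the tree: `QuasiSteadyTop.rowFqs_holds` (one-point comparison + row F1a).  No summit proved. -/
theorem row_F19_excluded : Row_F19 := QuasiSteadyTop.rowFqs_holds

/-- In-row sub-criterion F19fr (FROZEN top, `∂ₜu = 0` at the fast points near `T`), BY NAME `QuasiSteadyTop.Row_Ffrozen`. -/
def Row_F19fr : Prop := QuasiSteadyTop.Row_Ffrozen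

/-- F19fr is PROVED in the tree: `QuasiSteadyTop.rowFfrozen_holds`. -/
theorem row_F19fr_excluded : Row_F19fr := QuasiSteadyTop.rowFfrozen_holds

/-- In-row sub-criterion F19∂t (`‖∂ₜu(t)‖_∞ ≤ δ√ν (T−t)^{-3/2}` eventually, NO top restriction), BY NAME
`QuasiSteadyTop.Row_FdtSup`. -/
def Row_F19dt : Prop := QuasiSteadyTop.Row_FdtSup

/-- F19∂t is PROVED in the tree: `QuasiSteadyTop.rowFdtSup_holds`. -/
theorem row_F19dt_excluded : Row_F19dt := QuasiSteadyTop.rowFdtSup_holds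

/-- In-row Type-I member F1qs (frame of `Row_F1` verbatim + quasi-steady top), BY NAME `QuasiSteadyTop.Row_F1qs`. -/
def Row_F1qs : Prop := QuasiSteadyTop.Row_F1qs

/-- F1qs is PROVED in the tree: `QuasiSteadyTop.rowF1qs_holds`. -/
theorem row_F1qs_excluded : Row_F1qs := QuasiSteadyTop.rowF1qs_holds

/-- Lattice: F1a ⇒ F19 BY NAME (`QuasiSteadyTop.rowFqs_of_rowF1a`: the cell sits inside the quiet window F1a). -/
theorem row_F19_of_row_F1a (h : Row_F1a) : Row_F19 := QuasiSteadyTop.rowFqs_of_rowF1a h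

/-- Display for row F1: `Row_F1 ↔ QuasiSteadyTop.TypeIQuasiSteadiness` (every Type-I Clay blow-up, maximal frame, has a
quasi-steady top with some modulus `< 9 − 2√15`) — an exact reformulation, no value change. -/
theorem row_F1_iff_typeIQuasiSteadiness : Row_F1 ↔ QuasiSteadyTop.TypeIQuasiSteadiness :=
  QuasiSteadyTop.typeIQuasiSteadiness_iff_rowF1.symm

end Summit.NavierStokesRegularity.NavierStokesRegularity.Theorems.ScenarioCensus

end
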